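import Summits.PneNP.PneNP.Theorems.ConvexRankGatesCliqueExtLowerBoundWidthThresholdDefs

/-!
# CONV gates with few rows are real programs (line `width-threshold-certificate-sparsity`, reshape r6)

`conv_fewRows_classProgram`: a CONV gate with `p ≤ ⌊m^{1/16}⌋₊` constraint rows (ANY psd dimension
`q`, width `p + q ≤ m^c`) has the CLASS-PROGRAM PROPERTY at exponent `c`: for every class map
`cls : Fin n → Fin n'`, on class-constant inputs `v = u ∘ cls` the gate is the threshold `1 ≤ ·` of the
last wire of the monotone real straight-line program over the `n'` Boolean class leaves consisting of
the `p·n'` PREFIX SUMS `S_{i,κ} = ∑_{κ' ≤ κ} B'_{iκ'} [u κ']` of the MERGED weights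
`B'_{iκ} = ∑_{cls j = κ} B_{ij} ≥ 0` (binary gates `(z₀,z₁) ↦ z₀ + B'_{iκ} z₁`, unary for `κ = 0`)
followed by ONE `p`-ary monotone gate `z ↦ [∃ Y ⪰ 0, ∀ i, tr(Aᵢ Y) ≤ bᵢ + zᵢ]` reading the `p` full sums
(arity `0` when `n' = 0`): length `p·n' + 1 ≤ m^c (n'+1)`, fan-in `max 2 p ≤ ⌊m^{1/16}⌋₊`.
(`∑ⱼ B_{ij}[u (cls j)] = ∑_κ B'_{iκ}[u κ]` is `Finset.sum_fiberwise`.)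

References: S. Jukna, *Boolean Function Complexity* (2012), Thm. 9.21 (monotone real circuits)
[Jukna2012].
-/

set_option linter.dupNamespace false

open Literature.Computability.Complexity Filter Finset

namespace Summit.PneNP.PneNP.Theorems.CliqueExtLowerBound.WidthThreshold.ConvFewRows

/-! ## §1 Bookkeeping lemmas -/

/-- MERGING weights over the classes of a class map `cls`:
`∑ⱼ γⱼ [u (cls j)] = ∑_κ (∑_{cls j = κ} γⱼ) [u κ]` (`Finset.sum_fiberwise`). [folklore] -/
private theorem sum_classes {n n' : ℕ} (cls : Fin n → Fin n') (γ : Fin n → ℝ) (u : Fin n' → Bool) :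
    ∑ j, γ j * (if u (cls j) then (1 : ℝ) else 0) =
      ∑ κ, (∑ j ∈ univ.filter (fun j => cls j = κ), γ j) * (if u κ then (1 : ℝ) else 0) :=
  calc ∑ j, γ j * (if u (cls j) then (1 : ℝ) else 0)
      = ∑ κ, ∑ j ∈ univ.filter (fun j => cls j = κ), γ j * (if u (cls j) then (1 : ℝ) else 0) :=
        (sum_fiberwise univ cls _).symm
    _ = ∑ κ, (∑ j ∈ univ.filter (fun j => cls j = κ), γ j) * (if u κ then (1 : ℝ) else 0) :=
        sum_congr rfl fun κ _ => by
          rw [sum_mul]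
          exact sum_congr rfl fun j hj => by rw [(mem_filter.1 hj).2]

/-- `1 ≤ [P] ↔ P` for the real `0/1` indicator of a proposition. [folklore] -/
private theorem one_le_ite_iff (P : Prop) {_ : Decidable P} :
    (1 : ℝ) ≤ (if P then (1 : ℝ) else 0) ↔ P := by
  by_cases h : P <;> simp [h]

open Classical in
/-- The `0/1` indicator of SDP feasibility `[∃ Y ⪰ 0, ∀ i, tr(Aᵢ Y) ≤ bᵢ + zᵢ]` is MONOTONE in the
slack vector `z` (larger slacks relax every constraint). [folklore] -/
private theorem indicator_monotone {p q : ℕ} (A : Fin p → Matrix (Fin q) (Fin q) ℝ) (b : Fin p → ℝ) :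
    Monotone (fun z : Fin p → ℝ => if (∃ Y : Matrix (Fin q) (Fin q) ℝ, Y.PosSemidef ∧
      ∀ i, (A i * Y).trace ≤ b i + z i) then (1 : ℝ) else 0) := by
  intro z z' hz
  show (if _ then _ else _) ≤ (if _ then _ else _)
  by_cases h2 : ∃ Y : Matrix (Fin q) (Fin q) ℝ, Y.PosSemidef ∧ ∀ i, (A i * Y).trace ≤ b i + z' i
  · rw [if_pos h2]
    split_ifs <;> norm_num
  · have h1 : ¬ ∃ Y : Matrix (Fin q) (Fin q) ℝ, Y.PosSemidef ∧ ∀ i, (A i * Y).trace ≤ b i + z i :=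
      fun ⟨Y, hY, hi⟩ => h2 ⟨Y, hY, fun i => (hi i).trans (add_le_add le_rfl (hz i))⟩
    rw [if_neg h2, if_neg h1]

/-! ## §2 The program of prefix sums -/

open Classical in
/-- THE PROGRAM. For non-negative weights `B : Fin p → Fin n' → ℝ` there is a monotone real
straight-line program `ev` with `p·n' + 1` wires of fan-in `≤ max 2 p` over the `n'` Boolean leaves
whose last wire `t` satisfies `[∃ Y ⪰ 0, ∀ i, tr(Aᵢ Y) ≤ bᵢ + ∑_κ B_{iκ}[u κ]] ↔ 1 ≤ ev u t`: the wires
with index `κ + n'·i < p·n'` carry the prefix sums `∑_{κ' ≤ κ} B_{iκ'}[u κ']` (wire `(i,0)` is the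
unary gate `z ↦ B_{i0} z₀` of leaf `0`, wire `(i,κ+1)` the binary gate `(z₀,z₁) ↦ z₀ + B_{i,κ+1} z₁` of
wire `(i,κ)` and leaf `κ+1`), and the last wire is the `p`-ary monotone feasibility indicator of the
`p` full sums (the arity-`0` constant `[∃ Y ⪰ 0, ∀ i, tr(Aᵢ Y) ≤ bᵢ]` when `n' = 0`).
[cite: Jukna2012, Thm. 9.21] -/
private theorem program (p q n' : ℕ) (A : Fin p → Matrix (Fin q) (Fin q) ℝ) (b : Fin p → ℝ)
    (B : Fin p → Fin n' → ℝ) (hB : ∀ i κ, 0 ≤ B i κ) :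
    ∃ (ev : (Fin n' → Bool) → Fin (p * n' + 1) → ℝ) (t : Fin (p * n' + 1)),
      (∀ w : Fin (p * n' + 1), ∃ (k : ℕ) (src : Fin k → Fin n' ⊕ Fin (p * n' + 1))
        (ψ : (Fin k → ℝ) → ℝ), k ≤ max 2 p ∧ (∀ i t', src i = Sum.inr t' → t' < w) ∧ Monotone ψ ∧
        ∀ u : Fin n' → Bool, ev u w =
          ψ (fun i => Sum.elim (fun j => if u j then (1 : ℝ) else 0) (ev u) (src i))) ∧
      ∀ u : Fin n' → Bool, (∃ Y : Matrix (Fin q) (Fin q) ℝ, Y.PosSemidef ∧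
          ∀ i, (A i * Y).trace ≤ b i + ∑ κ, B i κ * (if u κ then (1 : ℝ) else 0)) ↔
        (1 : ℝ) ≤ ev u t := by
  rcases n' with _ | n
  · -- no leaves: one arity-`0` wire, the constant `[∃ Y ⪰ 0, ∀ i, tr(Aᵢ Y) ≤ bᵢ]`
    obtain ⟨c₀, hc₀⟩ : ∃ c₀ : ℝ, 1 ≤ c₀ ↔
        ∃ Y : Matrix (Fin q) (Fin q) ℝ, Y.PosSemidef ∧ ∀ i, (A i * Y).trace ≤ b i :=
      ⟨_, @one_le_ite_iff _ (Classical.dec _)⟩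
    refine ⟨fun _ _ => c₀, 0, fun w => ⟨0, fun l => l.elim0, fun _ => c₀, Nat.zero_le _,
      fun l => l.elim0, fun _ _ _ => le_rfl, fun _ => rfl⟩, fun u => ?_⟩
    simp only [univ_eq_empty, sum_empty, add_zero]
    exact hc₀.symm
  · -- `n' = n + 1 ≥ 1` leaves
    -- the feasibility indicator of a slack vector
    obtain ⟨ind, hmono, hind⟩ : ∃ ind : (Fin p → ℝ) → ℝ, Monotone ind ∧
        ∀ z, 1 ≤ ind z ↔ ∃ Y : Matrix (Fin q) (Fin q) ℝ, Y.PosSemidef ∧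
          ∀ i, (A i * Y).trace ≤ b i + z i :=
      ⟨_, indicator_monotone A b, fun z => one_le_ite_iff _⟩
    -- the prefix sums `S u i k = ∑_{κ < k} B_{iκ} [u κ]`
    obtain ⟨S, hS0, hS, hSn⟩ : ∃ S : (Fin (n + 1) → Bool) → Fin p → ℕ → ℝ,
        (∀ u i, S u i 0 = 0) ∧
        (∀ u i (κ : Fin (n + 1)), S u i ((κ : ℕ) + 1) = S u i κ + B i κ * (if u κ then 1 else 0)) ∧
        ∀ u i, S u i (n + 1) = ∑ κ, B i κ * (if u κ then (1 : ℝ) else 0) := by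
      refine ⟨fun u i k => ∑ l ∈ range k,
          if h : l < n + 1 then B i ⟨l, h⟩ * (if u ⟨l, h⟩ then 1 else 0) else 0,
        fun u i => sum_range_zero _, fun u i κ => ?_, fun u i => ?_⟩
      · simp only [sum_range_succ, dif_pos κ.is_lt, Fin.eta]
      · exact (sum_fin_eq_sum_range (fun κ => B i κ * (if u κ then (1 : ℝ) else 0))).symm
    refine ⟨fun u => Fin.snoc (α := fun _ => ℝ)
        (fun x : Fin (p * (n + 1)) =>
          S u (finProdFinEquiv.symm x).1 (((finProdFinEquiv.symm x).2 : ℕ) + 1))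
        (ind fun i => S u i (n + 1)), Fin.last _, fun w => ?_, fun u => ?_⟩
    · -- locality, wire by wire
      rcases Fin.eq_castSucc_or_eq_last w with ⟨x, rfl⟩ | rfl
      · -- a prefix-sum wire `(i, κ)`
        obtain ⟨⟨i, κ⟩, rfl⟩ := finProdFinEquiv.surjective x
        rcases Fin.eq_zero_or_eq_succ κ with rfl | ⟨κ, rfl⟩
        · -- `κ = 0`: unary gate `z ↦ B_{i0} z₀` of leaf `0`
          refine ⟨1, fun _ => Sum.inl 0, fun z => B i 0 * z 0,
            le_max_of_le_left (by norm_num), ?_, ?_, fun u => ?_⟩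
          · rintro _ t' ⟨⟩
          · exact fun z z' h => mul_le_mul_of_nonneg_left (h 0) (hB i 0)
          · simp only [Fin.snoc_castSucc, Equiv.symm_apply_apply, Sum.elim_inl]
            rw [hS u i 0, Fin.val_zero, hS0, zero_add]
        · -- `κ + 1`: binary gate `(z₀, z₁) ↦ z₀ + B_{i,κ+1} z₁` of wire `(i, κ)` and leaf `κ + 1`
          refine ⟨2, ![Sum.inr (Fin.castSucc (finProdFinEquiv (i, Fin.castSucc κ))),
              Sum.inl κ.succ], fun z => z 0 + B i κ.succ * z 1, le_max_left _ _, ?_, ?_, fun u => ?_⟩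
          · refine Fin.forall_fin_two.2 ⟨?_, ?_⟩
            · intro t' ht'
              simp only [Matrix.cons_val_zero, Sum.inr.injEq] at ht'
              subst ht'
              refine Fin.castSucc_lt_castSucc_iff.2 (Fin.lt_def.2 ?_)
              simp only [finProdFinEquiv_apply_val, Fin.val_succ, Fin.val_castSucc]
              omega
            · intro t' ht'
              simp at ht'
          · exact fun z z' h => add_le_add (h 0) (mul_le_mul_of_nonneg_left (h 1) (hB i _))
          · simp only [Fin.snoc_castSucc, Equiv.symm_apply_apply, Matrix.cons_val_zero,
              Matrix.cons_val_one, Sum.elim_inr, Sum.elim_inl]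
            rw [hS u i κ.succ, Fin.val_succ, Fin.val_castSucc]
      · -- the last wire: the `p`-ary feasibility indicator of the full sums
        refine ⟨p, fun i => Sum.inr (Fin.castSucc (finProdFinEquiv (i, Fin.last n))), ind,
          le_max_right _ _, ?_, hmono, fun u => ?_⟩
        · rintro i t' ⟨⟩
          exact Fin.castSucc_lt_last _
        · simp only [Fin.snoc_last, Sum.elim_inr, Fin.snoc_castSucc, Equiv.symm_apply_apply,
            Fin.val_last]
    · -- the value of the last wire
      simp only [Fin.snoc_last, hind, hSn]

/-! ## §3 The registered stub -/

open Classical in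
/-- **FEW-ROWS CONV GATES ARE REAL PROGRAMS** (registered stub `conv_fewRows_classProgram`, crux
stmt-PneNP-10682, line `width-threshold-certificate-sparsity`, reshape r6). A CONV gate
`f v = [∃ Y ⪰ 0, ∀ i < p, tr(Aᵢ Y) ≤ bᵢ + ∑ⱼ B_{ij}[vⱼ]]` (`B ≥ 0`) with `p ≤ ⌊m^{1/16}⌋₊` rows and
`p + q ≤ m^c` has the class-program property at exponent `c`: for every class map `cls` into `n'`
classes, on class-constant inputs it is the threshold `1 ≤ ·` of the last wire of a monotone real
straight-line program of length `p·n' + 1 ≤ m^c (n'+1)` and fan-in `max 2 p ≤ ⌊m^{1/16}⌋₊` over the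
class leaves (`program` applied to the merged weights `B'_{iκ} = ∑_{cls j = κ} B_{ij}`,
`sum_classes`). [cite: Jukna2012, Thm. 9.21] -/
theorem conv_fewRows_classProgram : ∀ (m c : ℕ) (φ : GateFn), 2 ≤ ⌊(m : ℝ) ^ (1 / 16 : ℝ)⌋₊ → (∃ p q : ℕ, p + q ≤ m ^ c ∧ p ≤ ⌊(m : ℝ) ^
    (1 / 16 : ℝ)⌋₊ ∧ ∃ (A : Fin p → Matrix (Fin q) (Fin q) ℝ) (b : Fin p → ℝ) (B : Fin p → Fin φ.1 →
    ℝ), (∀ i j, 0 ≤ B i j) ∧ ∀ v : Fin φ.1 → Bool, φ.2 v = true ↔ ∃ Y : Matrix (Fin q) (Fin q) ℝ,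
    Y.PosSemidef ∧ ∀ i, (A i * Y).trace ≤ b i + ∑ j, B i j * (if v j then (1 : ℝ) else 0)) → (∀ (n'
    : ℕ) (cls : Fin φ.1 → Fin n'), ∃ (T K : ℕ) (ev : (Fin n' → Bool) → Fin T → ℝ) (t : Fin T) (θ :
    ℝ), T ≤ m ^ c * (n' + 1) ∧ K ≤ ⌊(m : ℝ) ^ (1 / 16 : ℝ)⌋₊ ∧ (∀ w : Fin T, ∃ (k : ℕ) (src : Fin k
    → Fin n' ⊕ Fin T) (ψ : (Fin k → ℝ) → ℝ), k ≤ K ∧ (∀ i t', src i = Sum.inr t' → t' < w) ∧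
    Monotone ψ ∧ ∀ u : Fin n' → Bool, ev u w = ψ (fun i => Sum.elim (fun j => if u j then (1 : ℝ)
    else 0) (ev u) (src i))) ∧ ∀ u : Fin n' → Bool, φ.2 (fun j => u (cls j)) = true ↔ θ ≤ ev u t) := by
  intro m c φ hm hconv n' cls
  obtain ⟨p, q, hpq, hp, A, b, B, hB, hf⟩ := hconv
  -- merged weights `B'_{iκ} = ∑_{cls j = κ} B_{ij}`
  obtain ⟨B', hB'0, hB'sum⟩ : ∃ B' : Fin p → Fin n' → ℝ, (∀ i κ, 0 ≤ B' i κ) ∧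
      ∀ (u : Fin n' → Bool) (i : Fin p), ∑ j, B i j * (if u (cls j) then (1 : ℝ) else 0) =
        ∑ κ, B' i κ * (if u κ then (1 : ℝ) else 0) :=
    ⟨fun i κ => ∑ j ∈ univ.filter (fun j => cls j = κ), B i j,
      fun i κ => sum_nonneg fun j _ => hB i j, fun u i => sum_classes cls (B i) u⟩
  obtain ⟨ev, t, hloc, hval⟩ := program p q n' A b B' hB'0
  have hm1 : 1 ≤ m := by
    rcases Nat.eq_zero_or_pos m with rfl | h
    · rw [Nat.cast_zero, Real.zero_rpow (by norm_num), Nat.floor_zero] at hm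
      exact absurd hm (by norm_num)
    · exact h
  refine ⟨p * n' + 1, max 2 p, ev, t, 1, ?_, max_le hm hp, hloc, fun u => (hf _).trans ?_⟩
  · have hp' : p ≤ m ^ c := (Nat.le_add_right p q).trans hpq
    calc p * n' + 1 ≤ m ^ c * n' + m ^ c :=
          add_le_add (Nat.mul_le_mul_right _ hp') (Nat.one_le_pow _ _ hm1)
      _ = m ^ c * (n' + 1) := by ring
  · rw [← hval u]
    simp only [hB'sum u]

end Summit.PneNP.PneNP.Theorems.CliqueExtLowerBound.WidthThreshold.ConvFewRows
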